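import Literature.AlgebraicGeometry.Motives.HodgeStructureCatHomHodgePieces
import Literature.AlgebraicGeometry.Motives.HodgeStructureCatInternalHom
import HarnessLib

/-!
# Naturality of `Hom(P, Q)^{a,b} ≅ ⊕ Hom_ℂ(P^{-p,-q}, Q^{a-p,b-q})`: `Hom(f, g)^{a,b} ∘ E = E ∘ ⊕ Hom(f^{-p,-q}, g^{a-p,b-q})`

Layer `Literature/AlgebraicGeometry/Motives` (lane `lit-hodgefound`), the categorical dictionary of (mixed) Hodge structures, part V, pure case: the
decomposition of the Hodge pieces of the internal Hom of pure Hodge structures (`HodgeStructureCat.pieceHomEquiv`, `pieceHomCofan`,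
`Motives/HodgeStructureCatHomHodgePieces`) is natural for the bifunctor `Hom(f, g) : Hom(P, Q) ⟶ Hom(P', Q')`, `φ ↦ g ∘ φ ∘ f`
(`HodgeStructureCat.ihomMap`, `Motives/HodgeStructureCatInternalHom`).  E. Cattani et al. (eds.), *Hodge Theory* (Princeton Math. Notes 49, 2014)
[CattaniElZeinGriffithsLe2014], §3.1.1.3 (2) p0131–p0132 («`Hom(H,H')^{a,b} := ⊕_{p'−p=a,q'−q=b} Hom_ℂ(H^{p,q}, H'^{p',q'})`») with §3.1.1.2 (morphisms of HS
are compatible with the bigradings); P. Deligne, *Théorie de Hodge II* [DeligneHodgeII1971], 1.1.12 (`Hom` of filtered objects is functorial), 1.2.5.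

The proof follows the mixed case (`Motives/MixedHodgeStructureCatInternalHomDeligneSplitting` §3): on the summands `Hom(f, g)` acts by `h ↦ g^{a-p,b-q} ∘ h ∘ f^{-p,-q}`
(`pieceHomSummandMap`); the summand identifications `(P^∨)^{p,q} ⊗_ℂ Q^{a-p,b-q} ≃ Hom_ℂ(P^{-p,-q}, Q^{a-p,b-q})` intertwine `(f^∨)^{p,q} ⊗ g^{a-p,b-q}` with it
(the pairing is natural: `pieceDualPairing_pieceMap_transposeHom`, `Motives/HodgeStructureCatDualHodgePieces`); the Künneth map for `P^∨ ⊗ Q` is natural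
(`pieceMap_tensorHom_pieceTensorMap`, `Motives/HodgeStructureCatTensorHodgePieces`); and `Hom(f, g)` is the conjugate of `f^∨ ⊗ g` by `P^∨ ⊗ Q ⥲ Hom(P, Q)`
(`ihomIsoDualTensor_inv_comp_ihomMap`).

Everything is PROVED; no named fact, no instance, no notation.

## Main results

* §1 `pieceHomSummandMap` (`_apply`, `_id`, `_comp`), **`pieceHomSummandEquiv_naturality`**, `pieceHomSumMap` (`_lof`, `_id`, `_comp`).
* §2 `ihomMap_toLinearMap_dualTensorToHom_apply`, **`pieceMap_ihomMap_pieceHomTransfer`**, **`pieceMap_ihomMap_comp_pieceHomEquiv`** (`Hom(f,g)^{a,b} ∘ E = E ∘ ⊕ Hom(f,g)`),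
  `pieceMap_ihomMap_pieceHomEquiv`, `pieceHomEquiv_symm_pieceMap_ihomMap`.
* §3 in `ModuleCat ℂ`: **`pieceHomSummandMap_comp_pieceHomInj`** (naturality of the coprojections), `pieceHomDesc_naturality`.

## References

* [CattaniElZeinGriffithsLe2014] E. Cattani et al. (eds.), Hodge Theory, Princeton Math. Notes 49 (2014), §3.1.1.2, §3.1.1.3 (2).
* [DeligneHodgeII1971] P. Deligne, Théorie de Hodge II, Publ. Math. IHÉS 40 (1971), 1.1.12, 1.2.5.

## Provenance

Lane `lit-hodgefound` (summit `HodgeConjecture`), seat `lit-hodgefound-p36` (literature-prover, generation 48, row g48-#11).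
-/

noncomputable section

open CategoryTheory CategoryTheory.Limits
open scoped TensorProduct DirectSum

namespace Literature.AlgebraicGeometry.Motives

universe u

namespace HodgeStructureCat

open HodgeStructure (tensorBaseChange pieceTensorSummand pieceTensorMap pieceTensorEquiv pieceDualPairing pieceDualEquiv)

variable {n m : ℤ} (a b : ℤ) {P P' P'' : HodgeStructureCat.{u} n} {Q Q' Q'' : HodgeStructureCat.{u} m}

/-! ## §1 `Hom(f^{-p,-q}, g^{a-p,b-q})` on the summands and its compatibility with the summand identifications -/

section Summands

/-- **`Hom(f^{-p,-q}, g^{a-p,b-q}) : h ↦ g^{a-p,b-q} ∘ h ∘ f^{-p,-q}`** on the summand `Hom_ℂ(P^{-p,-q}, Q^{a-p,b-q})`, for `f : P' ⟶ P`, `g : Q ⟶ Q'`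
(contravariant in `P`). [cite: CattaniElZeinGriffithsLe2014, §3.1.1.3 (2) (ii) and §3.1.1.2] [cite: DeligneHodgeII1971, 1.1.12] -/
def pieceHomSummandMap (f : P' ⟶ P) (g : Q ⟶ Q') (pq : ℤ × ℤ) : pieceHomSummand a b P Q pq →ₗ[ℂ] pieceHomSummand a b P' Q' pq :=
  LinearMap.llcomp ℂ _ _ _ (pieceMap (a - pq.1) (b - pq.2) g) ∘ₗ LinearMap.lcomp ℂ _ (pieceMap (-pq.1) (-pq.2) f)

/-- `Hom(f^{-p,-q}, g^{a-p,b-q}) h = g^{a-p,b-q} ∘ h ∘ f^{-p,-q}`. [cite: CattaniElZeinGriffithsLe2014, §3.1.1.3 (2) (ii)] -/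
@[simp]
theorem pieceHomSummandMap_apply (f : P' ⟶ P) (g : Q ⟶ Q') (pq : ℤ × ℤ) (h : pieceHomSummand a b P Q pq) :
    pieceHomSummandMap a b f g pq h = pieceMap (a - pq.1) (b - pq.2) g ∘ₗ h ∘ₗ pieceMap (-pq.1) (-pq.2) f := rfl

variable (P Q) in
/-- `Hom(𝟙, 𝟙) = 𝟙` on each summand. [cite: DeligneHodgeII1971, 1.1.12] -/
theorem pieceHomSummandMap_id : pieceHomSummandMap a b (𝟙 P) (𝟙 Q) = fun _ => LinearMap.id := by
  funext pq
  refine LinearMap.ext fun h => ?_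
  rw [pieceHomSummandMap_apply, pieceMap_id, pieceMap_id, LinearMap.id_comp, LinearMap.comp_id, LinearMap.id_apply]

/-- Bifunctoriality on each summand: `Hom((f' ≫ f), (g ≫ g')) = Hom(f', g') ∘ Hom(f, g)`. [cite: DeligneHodgeII1971, 1.1.12] -/
theorem pieceHomSummandMap_comp (f : P' ⟶ P) (f' : P'' ⟶ P') (g : Q ⟶ Q') (g' : Q' ⟶ Q'') :
    pieceHomSummandMap a b (f' ≫ f) (g ≫ g') = fun pq => pieceHomSummandMap a b f' g' pq ∘ₗ pieceHomSummandMap a b f g pq := by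
  funext pq
  refine LinearMap.ext fun h => ?_
  rw [pieceHomSummandMap_apply, pieceMap_comp, pieceMap_comp, LinearMap.comp_apply, pieceHomSummandMap_apply, pieceHomSummandMap_apply]
  simp only [LinearMap.comp_assoc]

/-- **`⊕_{(p,q)} Hom(f^{-p,-q}, g^{a-p,b-q})`** on the direct sum. [cite: CattaniElZeinGriffithsLe2014, §3.1.1.3 (2) (ii)] -/
def pieceHomSumMap (f : P' ⟶ P) (g : Q ⟶ Q') :
    (⨁ pq : ℤ × ℤ, pieceHomSummand a b P Q pq) →ₗ[ℂ] ⨁ pq : ℤ × ℤ, pieceHomSummand a b P' Q' pq :=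
  DirectSum.lmap (pieceHomSummandMap a b f g)

/-- `pieceHomSumMap` on a summand. [cite: CattaniElZeinGriffithsLe2014, §3.1.1.3 (2) (ii)] -/
@[simp]
theorem pieceHomSumMap_lof (f : P' ⟶ P) (g : Q ⟶ Q') (pq : ℤ × ℤ) (h : pieceHomSummand a b P Q pq) :
    pieceHomSumMap a b f g (DirectSum.lof ℂ (ℤ × ℤ) (pieceHomSummand a b P Q) pq h) =
      DirectSum.lof ℂ (ℤ × ℤ) (pieceHomSummand a b P' Q') pq (pieceHomSummandMap a b f g pq h) := by
  classical
  exact DirectSum.lmap_lof (pieceHomSummandMap a b f g) pq h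

variable (P Q) in
/-- `⊕ Hom(𝟙, 𝟙) = 𝟙`. [cite: DeligneHodgeII1971, 1.1.12] -/
theorem pieceHomSumMap_id : pieceHomSumMap a b (𝟙 P) (𝟙 Q) = LinearMap.id := by
  rw [pieceHomSumMap, pieceHomSummandMap_id]
  exact DirectSum.lmap_id

/-- Bifunctoriality of `⊕ Hom(f, g)`. [cite: DeligneHodgeII1971, 1.1.12] -/
theorem pieceHomSumMap_comp (f : P' ⟶ P) (f' : P'' ⟶ P') (g : Q ⟶ Q') (g' : Q' ⟶ Q'') :
    pieceHomSumMap a b (f' ≫ f) (g ≫ g') = pieceHomSumMap a b f' g' ∘ₗ pieceHomSumMap a b f g := by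
  rw [pieceHomSumMap, pieceHomSummandMap_comp]
  exact DirectSum.lmap_comp _ _

end Summands

section SummandsNaturality

variable [HodgeTensorFacts.{u, u}] [Module.Finite ℚ P] [Module.Finite ℚ P']

/-- **Compatibility of the summand identifications with morphisms**: for `f : P' ⟶ P`, `g : Q ⟶ Q'`,
`e ((f^∨)^{p,q} ⊗ g^{a-p,b-q}) = Hom(f^{-p,-q}, g^{a-p,b-q}) ∘ e` (the pairing is natural: `⟨(f^∨)^{p,q} ξ, x⟩ = ⟨ξ, f^{-p,-q} x⟩`,
`pieceDualPairing_pieceMap_transposeHom`). [cite: CattaniElZeinGriffithsLe2014, §3.1.1.3 (2) (ii) and §3.1.1.2] -/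
theorem pieceHomSummandEquiv_naturality (f : P' ⟶ P) (g : Q ⟶ Q') (pq : ℤ × ℤ) (z : pieceTensorSummand P.str.dual Q.str a b pq) :
    pieceHomSummandEquiv a b P' Q' pq (pieceTensorSummandMap a b (transposeHom f) g pq z) =
      pieceHomSummandMap a b f g pq (pieceHomSummandEquiv a b P Q pq z) := by
  induction z using TensorProduct.induction_on with
  | zero => simp only [LinearMap.map_zero, LinearEquiv.map_zero]
  | add z₁ z₂ h₁ h₂ => simp only [LinearMap.map_add, LinearEquiv.map_add, h₁, h₂]
  | tmul ξ y =>
    refine LinearMap.ext fun x => ?_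
    rw [pieceTensorSummandMap_tmul, pieceHomSummandEquiv_tmul_apply, pieceHomSummandMap_apply, LinearMap.comp_apply, LinearMap.comp_apply,
      pieceHomSummandEquiv_tmul_apply, map_smul, pieceDualPairing_pieceMap_transposeHom]

end SummandsNaturality

/-! ## §2 Naturality of the decomposition `E : ⊕ Hom_ℂ(P^{-p,-q}, Q^{a-p,b-q}) ⥲ Hom(P, Q)^{a,b}` -/

section Naturality

variable [HodgeTensorFacts.{u, u}] [Module.Finite ℚ P] [Module.Finite ℚ P']

/-- `Hom(f, g) (dTH z) = dTH' ((f^∨ ⊗ g) z)` on vectors: the tree's isomorphism `P^∨ ⊗ Q ⥲ Hom(P, Q)` is natural (`ihomIsoDualTensor_inv_comp_ihomMap`).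
[cite: DeligneHodgeII1971, 1.1.12] -/
theorem ihomMap_toLinearMap_dualTensorToHom_apply (f : P' ⟶ P) (g : Q ⟶ Q') (z : Module.Dual ℚ P ⊗[ℚ] (Q : Type u)) :
    HodgeStructure.Hom.toLinearMap (ihomMap f g) ((HodgeStructure.Hom.dualTensorToHom P.str Q.str).toLinearMap z) =
      (HodgeStructure.Hom.dualTensorToHom P'.str Q'.str).toLinearMap ((HodgeStructure.Hom.tensorMap (HodgeStructure.Hom.dualMap f) g).toLinearMap z) :=
  congrArg (fun k => HodgeStructure.Hom.toLinearMap k z) (ihomIsoDualTensor_inv_comp_ihomMap f g)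

/-- **`Hom(f, g)^{a,b} ∘ transfer = transfer ∘ (f^∨ ⊗ g)^{a,b}`** on the pieces: the transfer `(P^∨ ⊗ Q)^{a,b} ⥲ Hom(P, Q)^{a,b}` of
`Motives/HodgeStructureCatHomHodgePieces` is natural. [cite: DeligneHodgeII1971, 1.1.12] [cite: CattaniElZeinGriffithsLe2014, §3.1.1.2] -/
theorem pieceMap_ihomMap_pieceHomTransfer (f : P' ⟶ P) (g : Q ⟶ Q') (w : (P.str.dual.tensor Q.str).piece a b) :
    pieceMap a b (ihomMap f g) (pieceHomTransfer a b P Q w) =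
      pieceHomTransfer a b P' Q' (pieceMap a b (tensorHom (transposeHom f) g) w) := by
  apply Subtype.ext
  change (HodgeStructure.Hom.toLinearMap (ihomMap f g)).baseChange ℂ
        ((HodgeStructure.Hom.dualTensorToHom P.str Q.str).toLinearMap.baseChange ℂ (w : ℂ ⊗[ℚ] (Module.Dual ℚ P ⊗[ℚ] (Q : Type u)))) =
      (HodgeStructure.Hom.dualTensorToHom P'.str Q'.str).toLinearMap.baseChange ℂ
        ((HodgeStructure.Hom.tensorMap (HodgeStructure.Hom.dualMap f) g).toLinearMap.baseChange ℂ (w : ℂ ⊗[ℚ] (Module.Dual ℚ P ⊗[ℚ] (Q : Type u))))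
  have key : HodgeStructure.Hom.toLinearMap (ihomMap f g) ∘ₗ (HodgeStructure.Hom.dualTensorToHom P.str Q.str).toLinearMap =
      (HodgeStructure.Hom.dualTensorToHom P'.str Q'.str).toLinearMap ∘ₗ (HodgeStructure.Hom.tensorMap (HodgeStructure.Hom.dualMap f) g).toLinearMap :=
    LinearMap.ext fun z => ihomMap_toLinearMap_dualTensorToHom_apply f g z
  have key' := congrArg (fun F => F.baseChange ℂ (w : ℂ ⊗[ℚ] (Module.Dual ℚ P ⊗[ℚ] (Q : Type u)))) key
  simp only [LinearMap.baseChange_comp, LinearMap.comp_apply] at key'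
  exact key'

/-- **Naturality of the decomposition of `Hom(P, Q)^{a,b}`**: for `f : P' ⟶ P`, `g : Q ⟶ Q'`,
`Hom(f, g)^{a,b} ∘ E_{P,Q} = E_{P',Q'} ∘ ⊕_{(p,q)} Hom(f^{-p,-q}, g^{a-p,b-q})` — the decomposition `Hom(H,H')^{a,b} = ⊕ Hom_ℂ(H^{p,q}, H'^{p',q'})` is compatible with
morphisms. [cite: CattaniElZeinGriffithsLe2014, §3.1.1.3 (2) (ii) and §3.1.1.2] [cite: DeligneHodgeII1971, 1.1.12] -/
theorem pieceMap_ihomMap_comp_pieceHomEquiv (f : P' ⟶ P) (g : Q ⟶ Q') :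
    pieceMap a b (ihomMap f g) ∘ₗ (pieceHomEquiv a b P Q).toLinearMap = (pieceHomEquiv a b P' Q').toLinearMap ∘ₗ pieceHomSumMap a b f g := by
  classical
  refine DirectSum.linearMap_ext ℂ fun pq => ?_
  refine (LinearMap.cancel_right (pieceHomSummandEquiv a b P Q pq).surjective).1 ?_
  refine TensorProduct.ext' fun ξ y => ?_
  change pieceMap a b (ihomMap f g) (pieceHomEquiv a b P Q
      (DirectSum.lof ℂ (ℤ × ℤ) (pieceHomSummand a b P Q) pq (pieceHomSummandEquiv a b P Q pq (ξ ⊗ₜ[ℂ] y)))) =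
    pieceHomEquiv a b P' Q' (pieceHomSumMap a b f g
      (DirectSum.lof ℂ (ℤ × ℤ) (pieceHomSummand a b P Q) pq (pieceHomSummandEquiv a b P Q pq (ξ ⊗ₜ[ℂ] y))))
  rw [pieceHomSumMap_lof, ← pieceHomSummandEquiv_naturality, pieceHomEquiv_lof_pieceHomSummandEquiv, pieceHomEquiv_lof_pieceHomSummandEquiv,
    ← pieceTensorSumMap_lof a b (transposeHom f) g pq (ξ ⊗ₜ[ℂ] y), ← pieceMap_tensorHom_pieceTensorMap a b (transposeHom f) g]
  exact pieceMap_ihomMap_pieceHomTransfer a b f g _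

/-- Pointwise form of the naturality. [cite: CattaniElZeinGriffithsLe2014, §3.1.1.3 (2) (ii)] -/
theorem pieceMap_ihomMap_pieceHomEquiv (f : P' ⟶ P) (g : Q ⟶ Q') (v : ⨁ pq : ℤ × ℤ, pieceHomSummand a b P Q pq) :
    pieceMap a b (ihomMap f g) (pieceHomEquiv a b P Q v) = pieceHomEquiv a b P' Q' (pieceHomSumMap a b f g v) :=
  LinearMap.congr_fun (pieceMap_ihomMap_comp_pieceHomEquiv a b f g) v

/-- Naturality for the inverse: `E⁻¹ ∘ Hom(f, g)^{a,b} = (⊕ Hom(f, g)) ∘ E⁻¹`. [cite: CattaniElZeinGriffithsLe2014, §3.1.1.3 (2) (ii)] -/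
theorem pieceHomEquiv_symm_pieceMap_ihomMap (f : P' ⟶ P) (g : Q ⟶ Q') (w : (P.str.hom Q.str).piece a b) :
    (pieceHomEquiv a b P' Q').symm (pieceMap a b (ihomMap f g) w) = pieceHomSumMap a b f g ((pieceHomEquiv a b P Q).symm w) := by
  apply (pieceHomEquiv a b P' Q').injective
  rw [LinearEquiv.apply_symm_apply, ← pieceMap_ihomMap_pieceHomEquiv, LinearEquiv.apply_symm_apply]

end Naturality

/-! ## §3 In `ModuleCat ℂ`: naturality of the coprojections and of the descent -/

section Categorical

variable [HodgeTensorFacts.{u, u}] [Module.Finite ℚ P] [Module.Finite ℚ P']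

/-- **Naturality of the coprojections**: `Hom(f^{-p,-q}, g^{a-p,b-q}) ≫ inj_{P',Q'} = inj_{P,Q} ≫ Hom(f, g)^{a,b}` in `ModuleCat ℂ`, for `f : P' ⟶ P`, `g : Q ⟶ Q'`.
[cite: CattaniElZeinGriffithsLe2014, §3.1.1.3 (2) (ii) and §3.1.1.2] -/
theorem pieceHomSummandMap_comp_pieceHomInj (f : P' ⟶ P) (g : Q ⟶ Q') (pq : ℤ × ℤ) :
    ModuleCat.ofHom (pieceHomSummandMap a b f g pq) ≫ pieceHomInj a b P' Q' pq =
      pieceHomInj a b P Q pq ≫ (pieceFunctor (m - n) a b).map (ihomMap f g) := by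
  refine ModuleCat.hom_ext (LinearMap.ext fun h => ?_)
  change pieceHomEquiv a b P' Q' (DirectSum.lof ℂ (ℤ × ℤ) (pieceHomSummand a b P' Q') pq (pieceHomSummandMap a b f g pq h)) =
    pieceMap a b (ihomMap f g) (pieceHomEquiv a b P Q (DirectSum.lof ℂ (ℤ × ℤ) (pieceHomSummand a b P Q) pq h))
  rw [pieceMap_ihomMap_pieceHomEquiv, pieceHomSumMap_lof]

/-- **Naturality of the descent**: for cofans `t`, `t'` on the summands of `(P, Q)`, `(P', Q')` and `φ : t.pt ⟶ t'.pt` compatible with the summand maps,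
`desc t ≫ φ = Hom(f, g)^{a,b} ≫ desc t'`. [cite: CattaniElZeinGriffithsLe2014, §3.1.1.3 (2) (ii)] -/
theorem pieceHomDesc_naturality (f : P' ⟶ P) (g : Q ⟶ Q') (t : Cofan (pieceHomSummandObj a b P Q)) (t' : Cofan (pieceHomSummandObj a b P' Q'))
    (φ : t.pt ⟶ t'.pt) (hφ : ∀ pq : ℤ × ℤ, t.inj pq ≫ φ = ModuleCat.ofHom (pieceHomSummandMap a b f g pq) ≫ t'.inj pq) :
    pieceHomDesc a b P Q t ≫ φ = (pieceFunctor (m - n) a b).map (ihomMap f g) ≫ pieceHomDesc a b P' Q' t' := by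
  apply pieceHom_hom_ext
  intro pq
  rw [← Category.assoc, pieceHomInj_comp_pieceHomDesc, ← Category.assoc, ← pieceHomSummandMap_comp_pieceHomInj, hφ, Category.assoc,
    pieceHomInj_comp_pieceHomDesc]

end Categorical

end HodgeStructureCat

end Literature.AlgebraicGeometry.Motives

end
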